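import Mathlib
import Summits.RiemannHypothesis.RiemannHypothesis.Theorems.WeilParityOffLineParityDetectionStubEvenOffLineCauchySchwarz
import HarnessLib

/-!
# Operator-Lipschitz dependence of the mirror-pairing form on the ordinates (helper file for
# stub RESIDUAL-COLLAPSE)

Route `WeilParity`, crux `OffLineParityDetection` (item stmt-RiemannHypothesis-15431), line
`registered`, stub `stub_residualCollapse` (RESIDUAL-COLLAPSE).  Pure real analysis on `L²(0, ∞)`
written with plain set integrals `∫ u in Ioi 0, …`; no zeta facts, no definitions.

For `η > 0` and a phase point `a` put `c_g(u) = e^{-ηu} cos(g(u-a))`, `s_g(u) = e^{-ηu} sin(g(u-a))`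
and, for a real profile `f`, `C_g = ∫₀^∞ f c_g`, `S_g = ∫₀^∞ f s_g`, `‖f‖² = ∫₀^∞ f²`.  One term of
the mirror-pairing form in normal form is `C_g² - S_g² = Re Y_g²`, `Y_g = C_g - i S_g`
(TORUS-analysis §1).  This file proves (RESIDUAL-analysis §2.2, the COLLAPSE tool):

* Euler's integrals `∫₀^∞ u^k e^{-ru} du = k!/r^{k+1}` and the second moment
  `ν(a)² = ∫₀^∞ (u-a)² e^{-2ηu} du = (1 - 2aη + 2a²η²)/(4η³) ≤ 1/(4η³)` for `0 ≤ a ≤ 1/η`;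
* `(C_g - C_h)² + (S_g - S_h)² ≤ (g-h)² ν(a)² ‖f‖²` (Cauchy–Schwarz and
  `|e^{-igv} - e^{-ihv}| ≤ |g-h||v|`) and `C_g² + S_g² ≤ ‖f‖²/(2η)`;
* hence the OPERATOR-LIPSCHITZ estimate of one term in its ordinate:
  `|(C_g² - S_g²) - (C_h² - S_h²)| ≤ (√2/(2η²)) |g - h| ‖f‖²` for `0 ≤ a ≤ 1/η`
  (`|Re Y_g² - Re Y_h²| ≤ |Y_g - Y_h| (|Y_g| + |Y_h|)`).

Everything is folklore and fully proved.
-/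

set_option linter.dupNamespace false

noncomputable section

namespace Summit.RiemannHypothesis.RiemannHypothesis.Theorems.WeilParityOffLineParityDetection

open MeasureTheory Set Filter
open scoped Topology

/-! ## Euler integrals and the second moment -/

/-- **Euler's integral** `∫₀^∞ u^k e^{-ru} du = k!/r^{k+1}` (`r > 0`, `k : ℕ`). [folklore] -/
theorem resColl_integral_pow_mul_exp (k : ℕ) {r : ℝ} (hr : 0 < r) :
    ∫ u in Ioi (0 : ℝ), u ^ k * Real.exp (-(r * u)) = k.factorial / r ^ (k + 1) := by
  -- adapted from Summits/AtomisticToContinuum/FouriersLaw (Euler integral via `Real.Gamma`)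
  have h := Real.integral_rpow_mul_exp_neg_mul_Ioi (a := (k : ℝ) + 1) (r := r) (by positivity) hr
  rw [add_sub_cancel_right, Real.Gamma_nat_eq_factorial] at h
  calc ∫ u in Ioi (0 : ℝ), u ^ k * Real.exp (-(r * u))
      = ∫ u in Ioi (0 : ℝ), u ^ (k : ℝ) * Real.exp (-(r * u)) := by
        refine setIntegral_congr_fun measurableSet_Ioi (fun u _ ↦ ?_)
        rw [Real.rpow_natCast]
    _ = (1 / r) ^ ((k : ℝ) + 1) * k.factorial := h
    _ = k.factorial / r ^ (k + 1) := by
        rw [show ((k : ℝ) + 1) = ((k + 1 : ℕ) : ℝ) by push_cast; ring, Real.rpow_natCast,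
          one_div_pow]
        ring

/-- `u^k e^{-ru}` is integrable on `(0, ∞)` (`r > 0`): its integral is non-zero. [folklore] -/
theorem resColl_integrableOn_pow_mul_exp (k : ℕ) {r : ℝ} (hr : 0 < r) :
    IntegrableOn (fun u : ℝ ↦ u ^ k * Real.exp (-(r * u))) (Ioi 0) := by
  refine Integrable.of_integral_ne_zero ?_
  rw [resColl_integral_pow_mul_exp k hr]
  positivity

/-- **The second moment**: `(u-a)² e^{-2ηu}` is integrable on `(0, ∞)` and
`∫₀^∞ (u-a)² e^{-2ηu} du = (1 - 2aη + 2a²η²)/(4η³)` (`η > 0`). [folklore] -/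
theorem resColl_second_moment {η : ℝ} (hη : 0 < η) (a : ℝ) :
    IntegrableOn (fun u : ℝ ↦ (u - a) ^ 2 * Real.exp (-(2 * η * u))) (Ioi 0) ∧
    ∫ u in Ioi (0 : ℝ), (u - a) ^ 2 * Real.exp (-(2 * η * u)) =
      (1 - 2 * a * η + 2 * a ^ 2 * η ^ 2) / (4 * η ^ 3) := by
  have hr : 0 < 2 * η := by positivity
  have i0 := resColl_integrableOn_pow_mul_exp 0 hr
  have i1 := resColl_integrableOn_pow_mul_exp 1 hr
  have i2 := resColl_integrableOn_pow_mul_exp 2 hr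
  have e : (fun u : ℝ ↦ (u - a) ^ 2 * Real.exp (-(2 * η * u))) =
      fun u ↦ (u ^ 2 * Real.exp (-(2 * η * u)) - 2 * a * (u ^ 1 * Real.exp (-(2 * η * u)))) +
        a ^ 2 * (u ^ 0 * Real.exp (-(2 * η * u))) := by
    funext u
    ring
  rw [e]
  have i21 : Integrable (fun u : ℝ ↦ u ^ 2 * Real.exp (-(2 * η * u)) -
      2 * a * (u ^ 1 * Real.exp (-(2 * η * u)))) (volume.restrict (Ioi 0)) :=
    i2.sub (i1.const_mul (2 * a))
  have i00 : Integrable (fun u : ℝ ↦ a ^ 2 * (u ^ 0 * Real.exp (-(2 * η * u))))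
      (volume.restrict (Ioi 0)) := i0.const_mul (a ^ 2)
  have i11 : Integrable (fun u : ℝ ↦ 2 * a * (u ^ 1 * Real.exp (-(2 * η * u))))
      (volume.restrict (Ioi 0)) := i1.const_mul (2 * a)
  refine ⟨i21.add i00, ?_⟩
  rw [integral_add i21 i00, integral_sub i2 i11, integral_const_mul, integral_const_mul,
    resColl_integral_pow_mul_exp 2 hr, resColl_integral_pow_mul_exp 1 hr,
    resColl_integral_pow_mul_exp 0 hr]
  simp only [Nat.factorial, Nat.succ_eq_add_one, Nat.cast_one, mul_one,
    zero_add, pow_one]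
  field_simp
  ring

/-- `ν(a)² = ∫₀^∞ (u-a)² e^{-2ηu} du ≤ 1/(4η³)` for `0 ≤ a ≤ 1/η`. [folklore] -/
theorem resColl_second_moment_le {η : ℝ} (hη : 0 < η) {a : ℝ} (ha0 : 0 ≤ a) (ha1 : a ≤ 1 / η) :
    ∫ u in Ioi (0 : ℝ), (u - a) ^ 2 * Real.exp (-(2 * η * u)) ≤ 1 / (4 * η ^ 3) := by
  rw [(resColl_second_moment hη a).2]
  have haη : a * η ≤ 1 := by rwa [le_div_iff₀ hη] at ha1
  have h : 2 * a ^ 2 * η ^ 2 ≤ 2 * a * η := by nlinarith [mul_nonneg ha0 hη.le]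
  exact div_le_div_of_nonneg_right (by linarith) (by positivity)

/-! ## Pointwise facts -/

/-- `(cos x - cos y)² + (sin x - sin y)² = 2 - 2cos(x - y) ≤ (x - y)²`. [folklore] -/
theorem resColl_trig_diff_sq_le (x y : ℝ) :
    (Real.cos x - Real.cos y) ^ 2 + (Real.sin x - Real.sin y) ^ 2 ≤ (x - y) ^ 2 := by
  have h : (Real.cos x - Real.cos y) ^ 2 + (Real.sin x - Real.sin y) ^ 2 =
      2 - 2 * Real.cos (x - y) := by
    rw [Real.cos_sub]
    linear_combination Real.cos_sq_add_sin_sq x + Real.cos_sq_add_sin_sq y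
  rw [h]
  linarith [Real.one_sub_sq_div_two_le_cos (x := x - y)]

/-- `e^{-ηu} · e^{-ηu} = e^{-2ηu}`. [folklore] -/
theorem resColl_exp_sq (η u : ℝ) :
    Real.exp (-(η * u)) ^ 2 = Real.exp (-(2 * η * u)) := by
  rw [sq, ← Real.exp_add]
  ring_nf

/-! ## Cauchy–Schwarz for a pair of pairings -/

/-- **Two pairings at once.**  For a continuous compactly supported real `f`, continuous `k₁, k₂`
with `k₁² + k₂² ≤ B` pointwise and `B` integrable on `(0, ∞)`:
`(∫₀^∞ f k₁)² + (∫₀^∞ f k₂)² ≤ ‖f‖² ∫₀^∞ B` (Cauchy–Schwarz twice). [folklore] -/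
theorem resColl_pair_sq_le {f : ℝ → ℝ} (hf : Continuous f) (hfs : HasCompactSupport f)
    {k₁ k₂ B : ℝ → ℝ} (hk₁ : Continuous k₁) (hk₂ : Continuous k₂) (hB : IntegrableOn B (Ioi 0))
    (hkB : ∀ u, k₁ u ^ 2 + k₂ u ^ 2 ≤ B u) :
    (∫ u in Ioi (0 : ℝ), f u * k₁ u) ^ 2 + (∫ u in Ioi (0 : ℝ), f u * k₂ u) ^ 2 ≤
      (∫ u in Ioi (0 : ℝ), f u ^ 2) * ∫ u in Ioi (0 : ℝ), B u := by
  have hf2 : Integrable (fun u ↦ f u ^ 2) (volume.restrict (Ioi (0 : ℝ))) :=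
    (((hf.mul hf).integrable_of_hasCompactSupport hfs.mul_right).integrableOn (s := Ioi 0)).congr
      (ae_of_all _ fun u ↦ (sq (f u)).symm)
  have hfk : ∀ {k : ℝ → ℝ}, Continuous k →
      Integrable (fun u ↦ f u * k u) (volume.restrict (Ioi (0 : ℝ))) := fun hk ↦
    ((hf.mul hk).integrable_of_hasCompactSupport hfs.mul_right).integrableOn
  have hk1sq : Integrable (fun u ↦ k₁ u ^ 2) (volume.restrict (Ioi (0 : ℝ))) := by
    refine Integrable.mono' hB (hk₁.pow 2).aestronglyMeasurable (ae_of_all _ fun u ↦ ?_)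
    rw [Real.norm_eq_abs, abs_of_nonneg (sq_nonneg _)]
    linarith [hkB u, sq_nonneg (k₂ u)]
  have hk2sq : Integrable (fun u ↦ k₂ u ^ 2) (volume.restrict (Ioi (0 : ℝ))) := by
    refine Integrable.mono' hB (hk₂.pow 2).aestronglyMeasurable (ae_of_all _ fun u ↦ ?_)
    rw [Real.norm_eq_abs, abs_of_nonneg (sq_nonneg _)]
    linarith [hkB u, sq_nonneg (k₁ u)]
  have h1 := sq_integral_mul_le hf2 hk1sq (hfk hk₁)
  have h2 := sq_integral_mul_le hf2 hk2sq (hfk hk₂)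
  have hsum : (∫ u in Ioi (0 : ℝ), k₁ u ^ 2) + ∫ u in Ioi (0 : ℝ), k₂ u ^ 2 ≤
      ∫ u in Ioi (0 : ℝ), B u := by
    rw [← integral_add hk1sq hk2sq]
    exact integral_mono (hk1sq.add hk2sq) hB hkB
  have hF0 : 0 ≤ ∫ u in Ioi (0 : ℝ), f u ^ 2 := integral_nonneg fun u ↦ sq_nonneg _
  calc (∫ u in Ioi (0 : ℝ), f u * k₁ u) ^ 2 + (∫ u in Ioi (0 : ℝ), f u * k₂ u) ^ 2
      ≤ (∫ u in Ioi (0 : ℝ), f u ^ 2) * (∫ u in Ioi (0 : ℝ), k₁ u ^ 2) +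
          (∫ u in Ioi (0 : ℝ), f u ^ 2) * ∫ u in Ioi (0 : ℝ), k₂ u ^ 2 := add_le_add h1 h2
    _ = (∫ u in Ioi (0 : ℝ), f u ^ 2) *
          ((∫ u in Ioi (0 : ℝ), k₁ u ^ 2) + ∫ u in Ioi (0 : ℝ), k₂ u ^ 2) := by ring
    _ ≤ (∫ u in Ioi (0 : ℝ), f u ^ 2) * ∫ u in Ioi (0 : ℝ), B u :=
        mul_le_mul_of_nonneg_left hsum hF0

/-- **One pairing** (Cauchy–Schwarz): `(∫₀^∞ f k)² ≤ ‖f‖² ∫₀^∞ k·k` for a continuous compactly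
supported real `f` and a continuous `k` with `k·k` integrable on `(0, ∞)`. [folklore] -/
theorem resColl_pairing_sq_le {f : ℝ → ℝ} (hf : Continuous f) (hfs : HasCompactSupport f)
    {k : ℝ → ℝ} (hk : Continuous k) (hkk : IntegrableOn (fun u ↦ k u * k u) (Ioi 0)) :
    (∫ u in Ioi (0 : ℝ), f u * k u) ^ 2 ≤
      (∫ u in Ioi (0 : ℝ), f u ^ 2) * ∫ u in Ioi (0 : ℝ), k u * k u := by
  have h := resColl_pair_sq_le hf hfs hk continuous_const (k₂ := fun _ ↦ 0) hkk
    (fun u ↦ by rw [sq, sq, mul_zero, add_zero])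
  simpa using h

/-! ## The two estimates on one ordinate -/

/-- **Size of one term**: `C_g² + S_g² ≤ ‖f‖²/(2η)` (`c_g² + s_g² = e^{-2ηu}`,
`∫₀^∞ e^{-2ηu} = 1/(2η)`). [folklore] -/
theorem resColl_term_sq_le {η : ℝ} (hη : 0 < η) (a : ℝ) {f : ℝ → ℝ} (hf : Continuous f)
    (hfs : HasCompactSupport f) (g : ℝ) :
    (∫ u in Ioi (0 : ℝ), f u * (Real.exp (-(η * u)) * Real.cos (g * (u - a)))) ^ 2 +
        (∫ u in Ioi (0 : ℝ), f u * (Real.exp (-(η * u)) * Real.sin (g * (u - a)))) ^ 2 ≤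
      (∫ u in Ioi (0 : ℝ), f u ^ 2) * (1 / (2 * η)) := by
  have hB : IntegrableOn (fun u : ℝ ↦ u ^ 0 * Real.exp (-(2 * η * u))) (Ioi 0) :=
    resColl_integrableOn_pow_mul_exp 0 (by positivity)
  have hBv : ∫ u in Ioi (0 : ℝ), u ^ 0 * Real.exp (-(2 * η * u)) = 1 / (2 * η) := by
    rw [resColl_integral_pow_mul_exp 0 (by positivity)]
    simp
  rw [← hBv]
  refine resColl_pair_sq_le hf hfs (by fun_prop) (by fun_prop) hB fun u ↦ le_of_eq ?_
  rw [mul_pow, mul_pow, ← mul_add, Real.cos_sq_add_sin_sq, mul_one, resColl_exp_sq, pow_zero,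
    one_mul]

/-- **Variation of one term in the ordinate**: for `0 ≤ a ≤ 1/η`,
`(C_g - C_h)² + (S_g - S_h)² ≤ ‖f‖² (g-h)²/(4η³)` (pointwise
`(c_g - c_h)² + (s_g - s_h)² = e^{-2ηu}(2 - 2cos((g-h)(u-a))) ≤ e^{-2ηu} (g-h)² (u-a)²`, then the
second moment bound). [folklore] -/
theorem resColl_term_diff_sq_le {η : ℝ} (hη : 0 < η) {a : ℝ} (ha0 : 0 ≤ a) (ha1 : a ≤ 1 / η)
    {f : ℝ → ℝ} (hf : Continuous f) (hfs : HasCompactSupport f) (g h : ℝ) :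
    ((∫ u in Ioi (0 : ℝ), f u * (Real.exp (-(η * u)) * Real.cos (g * (u - a)))) -
          ∫ u in Ioi (0 : ℝ), f u * (Real.exp (-(η * u)) * Real.cos (h * (u - a)))) ^ 2 +
        ((∫ u in Ioi (0 : ℝ), f u * (Real.exp (-(η * u)) * Real.sin (g * (u - a)))) -
          ∫ u in Ioi (0 : ℝ), f u * (Real.exp (-(η * u)) * Real.sin (h * (u - a)))) ^ 2 ≤
      (∫ u in Ioi (0 : ℝ), f u ^ 2) * ((g - h) ^ 2 * (1 / (4 * η ^ 3))) := by
  have hfk : ∀ {k : ℝ → ℝ}, Continuous k →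
      Integrable (fun u ↦ f u * k u) (volume.restrict (Ioi (0 : ℝ))) := fun hk ↦
    ((hf.mul hk).integrable_of_hasCompactSupport hfs.mul_right).integrableOn
  -- differences of pairings are pairings with differences
  have eC : (∫ u in Ioi (0 : ℝ), f u * (Real.exp (-(η * u)) * Real.cos (g * (u - a)))) -
      ∫ u in Ioi (0 : ℝ), f u * (Real.exp (-(η * u)) * Real.cos (h * (u - a))) =
      ∫ u in Ioi (0 : ℝ), f u * (Real.exp (-(η * u)) * Real.cos (g * (u - a)) -
        Real.exp (-(η * u)) * Real.cos (h * (u - a))) := by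
    rw [← integral_sub (hfk (by fun_prop)) (hfk (by fun_prop))]
    refine integral_congr_ae (ae_of_all _ fun u ↦ ?_)
    simp only [mul_sub]
  have eS : (∫ u in Ioi (0 : ℝ), f u * (Real.exp (-(η * u)) * Real.sin (g * (u - a)))) -
      ∫ u in Ioi (0 : ℝ), f u * (Real.exp (-(η * u)) * Real.sin (h * (u - a))) =
      ∫ u in Ioi (0 : ℝ), f u * (Real.exp (-(η * u)) * Real.sin (g * (u - a)) -
        Real.exp (-(η * u)) * Real.sin (h * (u - a))) := by
    rw [← integral_sub (hfk (by fun_prop)) (hfk (by fun_prop))]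
    refine integral_congr_ae (ae_of_all _ fun u ↦ ?_)
    simp only [mul_sub]
  rw [eC, eS]
  -- the dominating function `(g-h)² (u-a)² e^{-2ηu}`
  have hB : IntegrableOn (fun u : ℝ ↦ (g - h) ^ 2 * ((u - a) ^ 2 * Real.exp (-(2 * η * u))))
      (Ioi 0) := (resColl_second_moment hη a).1.const_mul _
  have hBv : ∫ u in Ioi (0 : ℝ), (g - h) ^ 2 * ((u - a) ^ 2 * Real.exp (-(2 * η * u))) ≤
      (g - h) ^ 2 * (1 / (4 * η ^ 3)) := by
    rw [integral_const_mul]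
    exact mul_le_mul_of_nonneg_left (resColl_second_moment_le hη ha0 ha1) (sq_nonneg _)
  refine le_trans (resColl_pair_sq_le hf hfs (by fun_prop) (by fun_prop) hB fun u ↦ ?_)
    (mul_le_mul_of_nonneg_left hBv (integral_nonneg fun u ↦ sq_nonneg _))
  -- pointwise: `e^{-2ηu} [(cos gv - cos hv)² + (sin gv - sin hv)²] ≤ e^{-2ηu} (g-h)² v²`
  have hpt := resColl_trig_diff_sq_le (g * (u - a)) (h * (u - a))
  calc (Real.exp (-(η * u)) * Real.cos (g * (u - a)) - Real.exp (-(η * u)) * Real.cos (h * (u - a))) ^ 2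
        + (Real.exp (-(η * u)) * Real.sin (g * (u - a)) - Real.exp (-(η * u)) * Real.sin (h * (u - a))) ^ 2
      = Real.exp (-(η * u)) ^ 2 * ((Real.cos (g * (u - a)) - Real.cos (h * (u - a))) ^ 2 +
          (Real.sin (g * (u - a)) - Real.sin (h * (u - a))) ^ 2) := by ring
    _ ≤ Real.exp (-(η * u)) ^ 2 * (g * (u - a) - h * (u - a)) ^ 2 :=
        mul_le_mul_of_nonneg_left hpt (sq_nonneg _)
    _ = (g - h) ^ 2 * ((u - a) ^ 2 * Real.exp (-(2 * η * u))) := by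
        rw [resColl_exp_sq]
        ring

/-- **Operator-Lipschitz estimate of one term** (RESIDUAL-analysis §2.2): for `η > 0`,
`0 ≤ a ≤ 1/η`, a continuous compactly supported real `f` and ordinates `g, h`,
`|(C_g² - S_g²) - (C_h² - S_h²)| ≤ (√2/(2η²)) |g - h| ‖f‖²`.  Proof:
`Δ = (C_g - C_h)(C_g + C_h) - (S_g - S_h)(S_g + S_h)`, Cauchy–Schwarz in `ℝ²`, the parallelogram
bound `(x+y)² ≤ 2x² + 2y²`, and the two estimates above. [folklore] -/
theorem resColl_term_lipschitz {η : ℝ} (hη : 0 < η) {a : ℝ} (ha0 : 0 ≤ a) (ha1 : a ≤ 1 / η)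
    {f : ℝ → ℝ} (hf : Continuous f) (hfs : HasCompactSupport f) (g h : ℝ) :
    |((∫ u in Ioi (0 : ℝ), f u * (Real.exp (-(η * u)) * Real.cos (g * (u - a)))) ^ 2 -
          (∫ u in Ioi (0 : ℝ), f u * (Real.exp (-(η * u)) * Real.sin (g * (u - a)))) ^ 2) -
        ((∫ u in Ioi (0 : ℝ), f u * (Real.exp (-(η * u)) * Real.cos (h * (u - a)))) ^ 2 -
          (∫ u in Ioi (0 : ℝ), f u * (Real.exp (-(η * u)) * Real.sin (h * (u - a)))) ^ 2)| ≤
      Real.sqrt 2 / (2 * η ^ 2) * |g - h| * ∫ u in Ioi (0 : ℝ), f u ^ 2 := by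
  set F := ∫ u in Ioi (0 : ℝ), f u ^ 2 with hF
  set Cg := ∫ u in Ioi (0 : ℝ), f u * (Real.exp (-(η * u)) * Real.cos (g * (u - a))) with hCg
  set Sg := ∫ u in Ioi (0 : ℝ), f u * (Real.exp (-(η * u)) * Real.sin (g * (u - a))) with hSg
  set Ch := ∫ u in Ioi (0 : ℝ), f u * (Real.exp (-(η * u)) * Real.cos (h * (u - a))) with hCh
  set Sh := ∫ u in Ioi (0 : ℝ), f u * (Real.exp (-(η * u)) * Real.sin (h * (u - a))) with hSh
  have hF0 : 0 ≤ F := integral_nonneg fun u ↦ sq_nonneg _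
  have h1 : (Cg - Ch) ^ 2 + (Sg - Sh) ^ 2 ≤ F * ((g - h) ^ 2 * (1 / (4 * η ^ 3))) :=
    resColl_term_diff_sq_le hη ha0 ha1 hf hfs g h
  have h2 : Cg ^ 2 + Sg ^ 2 ≤ F * (1 / (2 * η)) := resColl_term_sq_le hη a hf hfs g
  have h3 : Ch ^ 2 + Sh ^ 2 ≤ F * (1 / (2 * η)) := resColl_term_sq_le hη a hf hfs h
  have key : ((Cg ^ 2 - Sg ^ 2) - (Ch ^ 2 - Sh ^ 2)) ^ 2 ≤
      (Real.sqrt 2 / (2 * η ^ 2) * |g - h| * F) ^ 2 := by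
    have e : (Cg ^ 2 - Sg ^ 2) - (Ch ^ 2 - Sh ^ 2) =
        (Cg - Ch) * (Cg + Ch) - (Sg - Sh) * (Sg + Sh) := by ring
    have cs : ((Cg - Ch) * (Cg + Ch) - (Sg - Sh) * (Sg + Sh)) ^ 2 ≤
        ((Cg - Ch) ^ 2 + (Sg - Sh) ^ 2) * ((Cg + Ch) ^ 2 + (Sg + Sh) ^ 2) := by
      nlinarith [sq_nonneg ((Cg - Ch) * (Sg + Sh) + (Sg - Sh) * (Cg + Ch))]
    have par : (Cg + Ch) ^ 2 + (Sg + Sh) ^ 2 ≤ 2 * (Cg ^ 2 + Sg ^ 2) + 2 * (Ch ^ 2 + Sh ^ 2) := by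
      nlinarith [sq_nonneg (Cg - Ch), sq_nonneg (Sg - Sh)]
    have rhs : (Real.sqrt 2 / (2 * η ^ 2) * |g - h| * F) ^ 2 = (g - h) ^ 2 * F ^ 2 / (2 * η ^ 4) := by
      rw [mul_pow, mul_pow, div_pow, Real.sq_sqrt (by norm_num : (0 : ℝ) ≤ 2), sq_abs]
      field_simp
    rw [e, rhs]
    calc ((Cg - Ch) * (Cg + Ch) - (Sg - Sh) * (Sg + Sh)) ^ 2
        ≤ ((Cg - Ch) ^ 2 + (Sg - Sh) ^ 2) * ((Cg + Ch) ^ 2 + (Sg + Sh) ^ 2) := cs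
      _ ≤ (F * ((g - h) ^ 2 * (1 / (4 * η ^ 3)))) * (2 * (F * (1 / (2 * η))) + 2 * (F * (1 / (2 * η)))) :=
          mul_le_mul h1 (par.trans (by linarith)) (by positivity) (by positivity)
      _ = (g - h) ^ 2 * F ^ 2 / (2 * η ^ 4) := by
          field_simp
          ring
  exact abs_le_of_sq_le_sq key (by positivity)

/-! ## Summary statement (the registered sub-goal of this helper file) -/

/-- **Operator-Lipschitz dependence on the ordinate** (summary of this file): for `η > 0`,
`0 ≤ a ≤ 1/η`, every continuous compactly supported real `f` and all ordinates `g, h`, one term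
`C_g² - S_g²` of the mirror-pairing form in normal form (`C_g = ∫₀^∞ f e^{-ηu} cos(g(u-a))`,
`S_g = ∫₀^∞ f e^{-ηu} sin(g(u-a))`) satisfies `C_g² + S_g² ≤ ‖f‖²/(2η)` and
`|(C_g² - S_g²) - (C_h² - S_h²)| ≤ (√2/(2η²)) |g - h| ‖f‖²`. [folklore] -/
theorem resColl_lipschitz :
    ∀ η : ℝ, 0 < η → ∀ a : ℝ, 0 ≤ a → a ≤ 1 / η →
      ∀ f : ℝ → ℝ, Continuous f → HasCompactSupport f → ∀ g h : ℝ,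
        (∫ u in Set.Ioi (0 : ℝ), f u * (Real.exp (-(η * u)) * Real.cos (g * (u - a)))) ^ 2 +
            (∫ u in Set.Ioi (0 : ℝ), f u * (Real.exp (-(η * u)) * Real.sin (g * (u - a)))) ^ 2 ≤
          (∫ u in Set.Ioi (0 : ℝ), f u ^ 2) * (1 / (2 * η)) ∧
        |((∫ u in Set.Ioi (0 : ℝ), f u * (Real.exp (-(η * u)) * Real.cos (g * (u - a)))) ^ 2 -
              (∫ u in Set.Ioi (0 : ℝ), f u * (Real.exp (-(η * u)) * Real.sin (g * (u - a)))) ^ 2) -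
            ((∫ u in Set.Ioi (0 : ℝ), f u * (Real.exp (-(η * u)) * Real.cos (h * (u - a)))) ^ 2 -
              (∫ u in Set.Ioi (0 : ℝ), f u * (Real.exp (-(η * u)) * Real.sin (h * (u - a)))) ^ 2)| ≤
          Real.sqrt 2 / (2 * η ^ 2) * |g - h| * ∫ u in Set.Ioi (0 : ℝ), f u ^ 2 :=
  fun _ hη a ha0 ha1 _ hf hfs g h ↦
    ⟨resColl_term_sq_le hη a hf hfs g, resColl_term_lipschitz hη ha0 ha1 hf hfs g h⟩

end Summit.RiemannHypothesis.RiemannHypothesis.Theorems.WeilParityOffLineParityDetection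

end
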